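import Summits.AtomisticToContinuum.HydrodynamicLimit.Theses.RelayRaceLocality
import Summits.AtomisticToContinuum.HydrodynamicLimit.Theorems.RestartPrinciple.Negative.ConsequentImpAntecedent
import Summits.AtomisticToContinuum.HydrodynamicLimit.Theorems.RestartPrinciple.Negative.RestartSchema
import Summits.AtomisticToContinuum.HydrodynamicLimit.Theorems.RelayRaceLocalityRestartPrincipleOfConjunct
import HarnessLib

/-!
# STRATEGY CENSUS certificate, second opinion (r1) — crux `RestartPrinciple` (stmt-AtomisticToContinuum-12503)

Crux-strategist r1 evidence file, 2026-08-17 (unit `cstrat-stmt-AtomisticToContinuum-12503-r1`), companion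
of `STRATEGY-CENSUS.md` (r1). Nothing here is proposed to the tree; every non-trivial input is a NAME already
landed under `Theorems/`. It kernel-checks the statements the r1 census leans on:

* §1 CAPPED WITNESSES (decl-level form of the prefix defect p99454). The antecedent `S` of the crux is
  logically unchanged if its witnesses are forced under ANY positive caps `τ₁ ≤ κ M`, `σ₀ ≤ κ M`
  (`S_iff_SCap`), hence `RestartPrinciple ↔ (SCap κ → _root_.HydrodynamicLimit)` (`rp_iff_capped`). With
  `κ M = M⁻¹`: at every FIXED reduced density `σ` the antecedent binds no guard level `M ≥ σ⁻¹` and no time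
  `≥ M⁻¹` (`capped_clause_silent`), while the consequent (verbatim the sub-problem decl) demands, at that
  same `σ`, every horizon `T` below the classical lifespan, i.e. unbounded guard levels. So every proof of the
  crux contains the conjunct on the high-guard (pre-shock) time range with NO hypothesis in force there.
* §2 BRIDGE ANATOMY for the tribunal: `conjunct ↔ S ∧ RestartPrinciple` (landed p101123 + p132793): the route
  is the bridge split `G ⇐ T ∧ (T → G)` with `T = S` substantive; T1 cannot place `RestartPrinciple ≥ G`
  formally (that would prove `S`), the summit-strength is the §1 reading.
* §3 RESTART-FREE RIGIDITY (identity-theorem mechanisms, new in r1's inventory) needs an analytic LIMIT in the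
  continued variable; a field average that is analytic on `(0,T)` and frozen on an initial interval is frozen
  on `(0,T)` (`identity_rigidity`) — which finite propagation speed of the Euler limit forbids for compactly
  supported non-analytic data (census §Decomposition D5/D6).
* §4 THE HONEST RESIDUE AFTER A RETYPE (schema): with the diameter threshold fixed BEFORE the guard level, a
  fresh-data short-time statement `hS` plus a FORGETTING hypothesis `hF` (evolved law ≃ fresh local Gibbs law
  for future LLN purposes) entail the conjunct's shape by the landed `restart_induction` (`forgetting_schema`);
  by `prefixMfirst_schema_false` (p99454) the crux's own `S` (threshold under `∀ M`) cannot play `hS`.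
-/

noncomputable section

open Literature.MathematicalPhysics.KineticTheory Literature.Analysis.FluidPDE
open Literature.Analysis.FunctionSpaces MeasureTheory Filter Set Topology
open Summit.AtomisticToContinuum.HydrodynamicLimit.Theses.RelayRaceLocality
open Summit.AtomisticToContinuum.HydrodynamicLimit

namespace Summit.AtomisticToContinuum.HydrodynamicLimit.Cruxes.RestartPrinciple.StrategyCensusR1

/-! ## §1 Capped witnesses: `RestartPrinciple ↔ (SCap κ → conjunct)` -/

/-- The guard list of the crux at packing level `η₀` and size level `M`, on `[0, t]` (verbatim). -/
def Guards (η₀ M σ : ℝ) (ρ θ : ℝ → T3 → ℝ) (u : ℝ → T3 → V3) (t : ℝ) : Prop :=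
  ∀ s ∈ Set.Icc 0 t, ∀ x, ρ s x * σ ^ 3 < η₀ ∧ ρ s x ≤ M ∧ θ s x ≤ M ∧ M⁻¹ ≤ θ s x ∧ ‖u s x‖ ≤ M ∧ ∀ i j k : Fin 3, |Torus.partialDeriv i (ρ s) x| ≤ M ∧ ‖Torus.partialDeriv i (u s) x‖ ≤ M ∧ |Torus.partialDeriv i (θ s) x| ≤ M ∧ |Torus.partialDeriv i (Torus.partialDeriv j (ρ s)) x| ≤ M ∧ ‖Torus.partialDeriv i (Torus.partialDeriv j (u s)) x‖ ≤ M ∧ |Torus.partialDeriv i (Torus.partialDeriv j (θ s)) x| ≤ M ∧ |Torus.partialDeriv i (Torus.partialDeriv j (Torus.partialDeriv k (ρ s))) x| ≤ M ∧ ‖Torus.partialDeriv i (Torus.partialDeriv j (Torus.partialDeriv k (u s))) x‖ ≤ M ∧ |Torus.partialDeriv i (Torus.partialDeriv j (Torus.partialDeriv k (θ s))) x| ≤ M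

/-- The matrix of the antecedent below its witnesses `(η₀, M, τ₁, profile, σ)` (verbatim). -/
def Body (η₀ M τ₁ : ℝ) (a₀ θ₀ : T3 → ℝ) (u₀ : T3 → V3) (σ : ℝ) : Prop :=
  ∀ (T : ℝ) (ρ θ : ℝ → T3 → ℝ) (u : ℝ → T3 → V3), IsHardSphereEulerSolution σ T ρ u θ →
    ∀ Φ : (N : ℕ) → HardSphereFlow (Torus.geometry (Fin 3)) (hsDiameter σ N) (N + 1),
    TendstoHydroFieldsAt (fun N => localGibbsLaw σ a₀ u₀ θ₀ N (Φ N)) Φ ρ u θ 0 →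
    ∀ t ∈ Set.Ico 0 (min T τ₁), Guards η₀ M σ ρ θ u t →
    TendstoHydroFieldsAt (fun N => localGibbsLaw σ a₀ u₀ θ₀ N (Φ N)) Φ ρ u θ t

/-- `S`: the antecedent of the crux (short-time guarded HL from local-Gibbs time-0 data; prefix
`∃ η₀ ∀ M ∃ τ₁ ∀ profile ∃ σ₀ ∀ σ < σ₀`). -/
def S : Prop :=
  ∃ η₀ : ℝ, 0 < η₀ ∧ ∀ M : ℝ, 0 < M → ∃ τ₁ : ℝ, 0 < τ₁ ∧ ∀ (a₀ θ₀ : T3 → ℝ) (u₀ : T3 → V3),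
    Continuous a₀ → Continuous θ₀ → Continuous u₀ → (∀ x, 0 < a₀ x) → (∀ x, 0 < θ₀ x) →
    ∃ σ₀ : ℝ, 0 < σ₀ ∧ ∀ σ : ℝ, 0 < σ → σ < σ₀ → Body η₀ M τ₁ a₀ θ₀ u₀ σ

/-- `SCap κ`: the same statement with its witnesses forced under the caps `τ₁ ≤ κ M` and `σ₀ ≤ κ M`. -/
def SCap (κ : ℝ → ℝ) : Prop :=
  ∃ η₀ : ℝ, 0 < η₀ ∧ ∀ M : ℝ, 0 < M → ∃ τ₁ : ℝ, 0 < τ₁ ∧ τ₁ ≤ κ M ∧ ∀ (a₀ θ₀ : T3 → ℝ) (u₀ : T3 → V3),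
    Continuous a₀ → Continuous θ₀ → Continuous u₀ → (∀ x, 0 < a₀ x) → (∀ x, 0 < θ₀ x) →
    ∃ σ₀ : ℝ, 0 < σ₀ ∧ σ₀ ≤ κ M ∧ ∀ σ : ℝ, 0 < σ → σ < σ₀ → Body η₀ M τ₁ a₀ θ₀ u₀ σ

/-- The crux is literally `S → conjunct`. -/
theorem rp_iff : RestartPrinciple ↔ (S → _root_.HydrodynamicLimit) := Iff.rfl

/-- The matrix is monotone in the horizon: a shorter `τ₁` asks for less. -/
theorem Body.mono_τ {η₀ M τ₁ τ₁' : ℝ} {a₀ θ₀ : T3 → ℝ} {u₀ : T3 → V3} {σ : ℝ}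
    (h : Body η₀ M τ₁ a₀ θ₀ u₀ σ) (hle : τ₁' ≤ τ₁) : Body η₀ M τ₁' a₀ θ₀ u₀ σ := by
  intro T ρ θ u hsol Φ h0 t ht hg
  exact h T ρ θ u hsol Φ h0 t ⟨ht.1, lt_of_lt_of_le ht.2 (min_le_min_left T hle)⟩ hg

/-- Dropping the caps. -/
theorem S_of_SCap (κ : ℝ → ℝ) : SCap κ → S := by
  rintro ⟨η₀, hη₀, h⟩
  refine ⟨η₀, hη₀, fun M hM => ?_⟩
  obtain ⟨τ₁, hτ₁, -, h⟩ := h M hM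
  refine ⟨τ₁, hτ₁, fun a₀ θ₀ u₀ ha hθ hu ha0 hθ0 => ?_⟩
  obtain ⟨σ₀, hσ₀, -, h⟩ := h a₀ θ₀ u₀ ha hθ hu ha0 hθ0
  exact ⟨σ₀, hσ₀, h⟩

/-- Imposing the caps (shrink both witnesses; the matrix is monotone). -/
theorem SCap_of_S (κ : ℝ → ℝ) (hκ : ∀ M : ℝ, 0 < M → 0 < κ M) : S → SCap κ := by
  rintro ⟨η₀, hη₀, h⟩
  refine ⟨η₀, hη₀, fun M hM => ?_⟩
  obtain ⟨τ₁, hτ₁, h⟩ := h M hM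
  refine ⟨min τ₁ (κ M), lt_min hτ₁ (hκ M hM), min_le_right _ _, fun a₀ θ₀ u₀ ha hθ hu ha0 hθ0 => ?_⟩
  obtain ⟨σ₀, hσ₀, h⟩ := h a₀ θ₀ u₀ ha hθ hu ha0 hθ0
  refine ⟨min σ₀ (κ M), lt_min hσ₀ (hκ M hM), min_le_right _ _, fun σ hσ hσlt => ?_⟩
  exact (h σ hσ (lt_of_lt_of_le hσlt (min_le_left _ _))).mono_τ (min_le_left _ _)

/-- **Capped witnesses.** For ANY positive caps the antecedent is logically unchanged … -/
theorem S_iff_SCap (κ : ℝ → ℝ) (hκ : ∀ M : ℝ, 0 < M → 0 < κ M) : S ↔ SCap κ :=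
  ⟨SCap_of_S κ hκ, S_of_SCap κ⟩

/-- … hence the crux is EQUIVALENT to "capped short-time limit ⇒ conjunct": whatever proves the crux proves
the conjunct from a hypothesis whose step `τ₁(M)` and diameter threshold `σ₀(M, profile)` are as small as
one pleases, level by level. -/
theorem rp_iff_capped (κ : ℝ → ℝ) (hκ : ∀ M : ℝ, 0 < M → 0 < κ M) :
    RestartPrinciple ↔ (SCap κ → _root_.HydrodynamicLimit) := by
  rw [rp_iff]
  exact ⟨fun h hc => h (S_of_SCap κ hc), fun h hs => h (SCap_of_S κ hκ hs)⟩

/-- The instance `κ M := M⁻¹`. -/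
theorem rp_iff_capped_inv :
    RestartPrinciple ↔ (SCap (fun M => M⁻¹) → _root_.HydrodynamicLimit) :=
  rp_iff_capped _ (fun _ hM => inv_pos.2 hM)

/-- THE READING. Under the cap `σ₀ ≤ M⁻¹`, at reduced density `σ` the level-`M` clause of the antecedent
binds NO diameter as soon as `M⁻¹ ≤ σ`: its range `σ' < σ₀ ≤ M⁻¹ ≤ σ` excludes `σ`. Since the consequent
fixes `σ` first and then asks for every horizon `T` (guard level of the classical solution unbounded as `T`
approaches the lifespan), the crux contains, at every admissible `σ`, the conjunct on the time range where the
`C³` guards exceed `σ⁻¹`, with no usable hypothesis. -/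
theorem capped_clause_silent {σ σ₀ M : ℝ} (hcap : σ₀ ≤ M⁻¹) (hM : M⁻¹ ≤ σ) : ¬ σ < σ₀ :=
  not_lt.2 (hcap.trans hM)

/-- Quantitatively: the guard levels the antecedent can ever speak about at density `σ` are `M < σ⁻¹`. -/
theorem usable_level_lt {σ σ₀ M : ℝ} (hσ : 0 < σ) (hM : 0 < M) (hcap : σ₀ ≤ M⁻¹) (huse : σ < σ₀) :
    M < σ⁻¹ := by
  have h1 : σ < M⁻¹ := lt_of_lt_of_le huse hcap
  rwa [lt_inv_comm₀ hσ hM] at h1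

/-! ## §2 Bridge anatomy (for the tribunal) -/

/-- `conjunct → S` (p101123, by name). -/
theorem S_of_conjunct : _root_.HydrodynamicLimit → S :=
  fun h => Theorems.RestartPrincipleNegative.guardedConjunct_imp_shortTimeGuardedHL h

/-- `conjunct → RestartPrinciple` (p132793, by name). -/
theorem rp_of_conjunct : _root_.HydrodynamicLimit → RestartPrinciple :=
  Theorems.RestartPrinciple.restartPrinciple_of_hydrodynamicLimit

/-- **The route is a bridge split of the summit conjunct**: `G ↔ S ∧ (S → G)`, with `S` open and
substantive and `S → G` the crux. Consequently `RestartPrinciple → G` cannot be certified without proving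
`S` (T1 has no formal placing `≥ G`); the crux is summit-strength only in the §1 sense. -/
theorem conjunct_iff_S_and_rp : _root_.HydrodynamicLimit ↔ (S ∧ RestartPrinciple) :=
  ⟨fun h => ⟨S_of_conjunct h, rp_of_conjunct h⟩, fun h => h.2 h.1⟩

/-- What a formal `RestartPrinciple → G` would hand the tribunal: a proof of `S`. -/
theorem S_of_rp_imp_conjunct (h : RestartPrinciple → _root_.HydrodynamicLimit) (hrp : RestartPrinciple) : S :=
  S_of_conjunct (h hrp)

/-! ## §3 Restart-free rigidity needs an analytic limit (identity-theorem mechanisms) -/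

/-- If a limiting field average `g` is real-analytic about every point of `(0, T)` and equals the constant
`c` on an initial interval `(0, t₁)` (the sound cone has not yet reached the test function), then `g = c` on
all of `(0, T)`. Finite propagation speed makes the Euler limit of compactly supported non-analytic data
exactly "frozen, then moving" — so no `N`-uniform analytic continuation of the `N`-particle averages (which
would force an analytic limit by normality) can exist: census D5/D6. -/
theorem identity_rigidity {g : ℝ → ℝ} {T t₁ c : ℝ} (ht₁ : 0 < t₁) (ht₁T : t₁ ≤ T)
    (hg : AnalyticOnNhd ℝ g (Set.Ioo 0 T)) (hinit : ∀ t ∈ Set.Ioo 0 t₁, g t = c) :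
    ∀ t ∈ Set.Ioo 0 T, g t = c := by
  have hz : t₁ / 2 ∈ Set.Ioo 0 T := ⟨by positivity, by linarith⟩
  have hev : g =ᶠ[𝓝 (t₁ / 2)] fun _ => c := by
    have hmem : Set.Ioo 0 t₁ ∈ 𝓝 (t₁ / 2) := Ioo_mem_nhds (by positivity) (by linarith)
    exact Filter.eventually_of_mem hmem fun t ht => hinit t ht
  exact hg.eqOn_of_preconnected_of_eventuallyEq analyticOnNhd_const isPreconnected_Ioo hz hev

/-- Contrapositive, the form used in the census: a limit that is frozen on `(0,t₁)` but moves at some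
`t ∈ (0,T)` is not analytic on `(0,T)`. -/
theorem not_analytic_of_frozen_then_moving {g : ℝ → ℝ} {T t₁ c : ℝ} (ht₁ : 0 < t₁) (ht₁T : t₁ ≤ T)
    (hinit : ∀ t ∈ Set.Ioo 0 t₁, g t = c) (hmove : ∃ t ∈ Set.Ioo 0 T, g t ≠ c) :
    ¬ AnalyticOnNhd ℝ g (Set.Ioo 0 T) := by
  intro hg
  obtain ⟨t, ht, hne⟩ := hmove
  exact hne (identity_rigidity ht₁ ht₁T hg hinit t ht)

/-! ## §4 The honest residue after a retype (schema) -/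

/-- **Forgetting schema.** `L t` = "the LLN holds at time `t` for the TRUE gas (local Gibbs at time 0)";
`Lfresh s t'` = "the LLN holds at time `t'` for the FRESH gas re-Gibbsified at time `s` (local Gibbs law
with the Euler-evolved profile at `s`)"; `size` = guard level of the classical solution. Hypotheses:
`hS` = a fresh-data short-time statement whose diameter threshold has ALREADY been fixed (σ does not appear:
it was chosen before `M`), applied at every profile met along the solution; `hF` = FORGETTING (the evolved law
is as good as the fresh one for future LLN purposes); `hsize` = finite size at every time. Conclusion: the
conjunct's shape, by the landed `restart_induction` (p99454). This is the typed shape of the only honest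
`S`-consuming decomposition (census D8); `prefixMfirst_schema_false` shows the crux's OWN antecedent (threshold
under `∀ M`) cannot serve as `hS`. -/
theorem forgetting_schema (L : ℝ → Prop) (Lfresh : ℝ → ℝ → Prop) (size : ℝ → ℝ)
    (hS : ∀ M : ℝ, 0 < M → ∃ τ₁ : ℝ, 0 < τ₁ ∧ ∀ s : ℝ, 0 ≤ s → ∀ t' ∈ Ico 0 τ₁,
      (∀ r ∈ Icc 0 (s + t'), size r ≤ M) → Lfresh s t')
    (hF : ∀ s : ℝ, 0 ≤ s → L s → ∀ t' : ℝ, 0 ≤ t' → Lfresh s t' → L (s + t'))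
    (hsize : ∀ t : ℝ, ∃ M : ℝ, 0 < M ∧ ∀ s ∈ Icc 0 t, size s ≤ M) (h0 : L 0) :
    ∀ t : ℝ, 0 ≤ t → L t := by
  refine Theorems.RestartPrincipleNegative.restart_induction L size ?_ hsize h0
  intro M hM
  obtain ⟨τ₁, hτ₁, hst⟩ := hS M hM
  refine ⟨τ₁, hτ₁, fun s₀ hs₀ hL t ht hguard => ?_⟩
  have ht' : t - s₀ ∈ Ico 0 τ₁ := ⟨sub_nonneg.2 ht.1, by linarith [ht.2]⟩
  have heq : s₀ + (t - s₀) = t := by ring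
  have hfresh : Lfresh s₀ (t - s₀) := hst s₀ hs₀ (t - s₀) ht' (by rw [heq]; exact hguard)
  have := hF s₀ hs₀ hL (t - s₀) ht'.1 hfresh
  rwa [heq] at this

/-- Recorded by name so the schema facts of the two censuses elaborate together. -/
example := @Theorems.RestartPrincipleNegative.prefixMfirst_schema_false
example := @Theorems.RestartPrincipleNegative.anchored_schema_false

end Summit.AtomisticToContinuum.HydrodynamicLimit.Cruxes.RestartPrinciple.StrategyCensusR1

end
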